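import Summits.CriticalPhenomena.PercolationContinuityZ3.Theorems.Transplant.SkeletonRankDefs
import Mathlib.Tactic.FinCases
import HarnessLib

/-!
# The higher Heisenberg groups `H_{2k+1}(ℤ)` and their Cayley graphs (class map, memo `P4-GENERAL.md` §12)

builds on p205010 (kernel theorem, internal audit signed; external expert review pending) — nothing in this file uses p205010.
Lane `prim-bschramm`, seat `prim-bschramm-p4` (gen 4; class C3, class map), helper file (`--supports stmt-CriticalPhenomena-4575`).
First file of the series `HeisenbergK*.lean` making the memo's tier-1d entry "H_{2k+1} over (a₁,b₁): (Z-slab) ✓ — A otherwise" (§11.1/11.2)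
a kernel theorem for every `k ≥ 2` (`k = 1` is `H₃(ℤ)`, the lane's tier 1b).

COORDINATES.  `H_{2k+1}(ℤ)` on `HK k = ℤ^k × ℤ^k × ℤ` ("`(a, b, c)`") with
  `(a,b,c)·(a',b',c') = (a+a', b+b', c+c'+Σ_i a_i b'_i)`,  identity `0`,  `(a,b,c)⁻¹ = (−a, −b, −c + Σ a_i b_i)`;
generators `A_i = (δ_i,0,0)`, `B_i = (0,δ_i,0)` with `[A_i, B_i] = C = (0,0,1)` and `[A_i, B_j] = [A_i, A_j] = [B_i, B_j] = 1` (`i ≠ j`).  The right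
Cayley graph `hkGraph k`: `x ∼ x A_i^{±1}`, `x ∼ x B_i^{±1}`.  This file: group law (§1), generators and graph, local finiteness (§2), left
translations as automorphisms, transitivity, root-independence of `θ`/`p_c` (§3), the coordinate projections used by the rank-2 skeleton
`(a_j, b_j)` (1-Lipschitz, §4). [cite: BenjaminiSchramm1996, §2 (Cayley graphs), Conj. 4]
[cite: ContrerasMartineauTassion2024, §1.1 (nilpotent Cayley graphs, the Heisenberg example)] [cite: KozmaNitzan2024, §4 p. 15]
-/

noncomputable section

namespace Summit.CriticalPhenomena.PercolationContinuityZ3.Theorems.Transplant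

open MeasureTheory Literature.Probability.Percolation Literature.Probability.LatticeModels
open Literature.Barriers.CriticalPhenomena (IsGraphTransitive IsQuasiTransitive)

/-! ## §1 The group law -/

/-- The carrier of `H_{2k+1}(ℤ)`: triples `(a, b, c)`, `a, b ∈ ℤ^k`, `c ∈ ℤ`. [folklore] -/
abbrev HK (k : ℕ) : Type := (Fin k → ℤ) × (Fin k → ℤ) × ℤ

variable {k : ℕ}

/-- The pairing `⟨a, b'⟩ = Σ_i a_i b'_i`. [folklore] -/
def hkDot (a b : Fin k → ℤ) : ℤ := ∑ i, a i * b i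

/-- Multiplication `(a,b,c)·(a',b',c') = (a+a', b+b', c+c'+Σ a_i b'_i)`. [folklore] -/
def hkMul (x y : HK k) : HK k := (x.1 + y.1, x.2.1 + y.2.1, x.2.2 + y.2.2 + hkDot x.1 y.2.1)

/-- Inversion `(a,b,c)⁻¹ = (−a, −b, −c + Σ a_i b_i)`. [folklore] -/
def hkInv (x : HK k) : HK k := (-x.1, -x.2.1, -x.2.2 + hkDot x.1 x.2.1)

/-- `a`-part of a product. [folklore] -/
@[simp] theorem hkMul_a (x y : HK k) : (hkMul x y).1 = x.1 + y.1 := rfl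
/-- `b`-part of a product. [folklore] -/
@[simp] theorem hkMul_b (x y : HK k) : (hkMul x y).2.1 = x.2.1 + y.2.1 := rfl
/-- `c`-part of a product. [folklore] -/
@[simp] theorem hkMul_c (x y : HK k) : (hkMul x y).2.2 = x.2.2 + y.2.2 + hkDot x.1 y.2.1 := rfl

/-- The pairing is additive on the left. [folklore] -/
theorem hkDot_add_left (a a' b : Fin k → ℤ) : hkDot (a + a') b = hkDot a b + hkDot a' b := by
  simp [hkDot, add_mul, Finset.sum_add_distrib]
/-- The pairing is additive on the right. [folklore] -/
theorem hkDot_add_right (a b b' : Fin k → ℤ) : hkDot a (b + b') = hkDot a b + hkDot a b' := by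
  simp [hkDot, mul_add, Finset.sum_add_distrib]
/-- `⟨0, b⟩ = 0`. [folklore] -/
@[simp] theorem hkDot_zero_left (b : Fin k → ℤ) : hkDot 0 b = 0 := by simp [hkDot]
/-- `⟨a, 0⟩ = 0`. [folklore] -/
@[simp] theorem hkDot_zero_right (a : Fin k → ℤ) : hkDot a 0 = 0 := by simp [hkDot]
/-- `⟨−a, b⟩ = −⟨a,b⟩`. [folklore] -/
@[simp] theorem hkDot_neg_left (a b : Fin k → ℤ) : hkDot (-a) b = -hkDot a b := by simp [hkDot]
/-- `⟨a, −b⟩ = −⟨a,b⟩`. [folklore] -/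
@[simp] theorem hkDot_neg_right (a b : Fin k → ℤ) : hkDot a (-b) = -hkDot a b := by simp [hkDot]
/-- `⟨δ_i s, b⟩ = s b_i`. [folklore] -/
@[simp] theorem hkDot_single_left (i : Fin k) (s : ℤ) (b : Fin k → ℤ) : hkDot (Pi.single i s) b = s * b i := by
  simp [hkDot, Pi.single_apply, Finset.sum_ite_eq']
/-- `⟨a, δ_i s⟩ = a_i s`. [folklore] -/
@[simp] theorem hkDot_single_right (a : Fin k → ℤ) (i : Fin k) (s : ℤ) : hkDot a (Pi.single i s) = a i * s := by
  simp [hkDot, Pi.single_apply, Finset.sum_ite_eq']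

/-- Associativity. [folklore] -/
theorem hkMul_assoc (x y z : HK k) : hkMul (hkMul x y) z = hkMul x (hkMul y z) := by
  refine Prod.ext ?_ (Prod.ext ?_ ?_)
  · simp [add_assoc]
  · simp [add_assoc]
  · simp only [hkMul_c, hkMul_a, hkMul_b, hkDot_add_left, hkDot_add_right]; abel

/-- `0` is a right identity. [folklore] -/
@[simp] theorem hkMul_zero (x : HK k) : hkMul x 0 = x := by
  refine Prod.ext ?_ (Prod.ext ?_ ?_) <;> simp
/-- `0` is a left identity. [folklore] -/
@[simp] theorem zero_hkMul (x : HK k) : hkMul 0 x = x := by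
  refine Prod.ext ?_ (Prod.ext ?_ ?_) <;> simp
/-- Left inverse. [folklore] -/
@[simp] theorem hkInv_mul (x : HK k) : hkMul (hkInv x) x = 0 := by
  refine Prod.ext ?_ (Prod.ext ?_ ?_)
  · simp [hkInv]
  · simp [hkInv]
  · simp only [hkMul_c, hkInv, hkDot_neg_left]; abel
/-- Right inverse. [folklore] -/
@[simp] theorem mul_hkInv (x : HK k) : hkMul x (hkInv x) = 0 := by
  refine Prod.ext ?_ (Prod.ext ?_ ?_)
  · simp [hkInv]
  · simp [hkInv]
  · simp only [hkMul_c, hkInv, hkDot_neg_right]; abel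

/-- Left multiplication is injective. [folklore] -/
theorem hkMul_right_injective (g : HK k) : Function.Injective (hkMul g) := by
  intro x y h
  have := congrArg (hkMul (hkInv g)) h
  simpa [← hkMul_assoc] using this

/-! ## §2 Generators and the Cayley graph -/

/-- `A_i = (δ_i, 0, 0)`. [folklore] -/
def hkA (i : Fin k) : HK k := (Pi.single i 1, 0, 0)
/-- `B_i = (0, δ_i, 0)`. [folklore] -/
def hkB (i : Fin k) : HK k := (0, Pi.single i 1, 0)
/-- `A_i⁻¹ = (−δ_i, 0, 0)`. [folklore] -/
def hkAinv (i : Fin k) : HK k := (-Pi.single i 1, 0, 0)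
/-- `B_i⁻¹ = (0, −δ_i, 0)`. [folklore] -/
def hkBinv (i : Fin k) : HK k := (0, -Pi.single i 1, 0)

/-- `A_i A_i⁻¹ = 1`. [folklore] -/
@[simp] theorem hkA_mul_hkAinv (i : Fin k) : hkMul (hkA i : HK k) (hkAinv i) = 0 := by
  refine Prod.ext ?_ (Prod.ext ?_ ?_) <;> simp [hkA, hkAinv]
/-- `A_i⁻¹ A_i = 1`. [folklore] -/
@[simp] theorem hkAinv_mul_hkA (i : Fin k) : hkMul (hkAinv i : HK k) (hkA i) = 0 := by
  refine Prod.ext ?_ (Prod.ext ?_ ?_) <;> simp [hkA, hkAinv]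
/-- `B_i B_i⁻¹ = 1`. [folklore] -/
@[simp] theorem hkB_mul_hkBinv (i : Fin k) : hkMul (hkB i : HK k) (hkBinv i) = 0 := by
  refine Prod.ext ?_ (Prod.ext ?_ ?_) <;> simp [hkB, hkBinv]
/-- `B_i⁻¹ B_i = 1`. [folklore] -/
@[simp] theorem hkBinv_mul_hkB (i : Fin k) : hkMul (hkBinv i : HK k) (hkB i) = 0 := by
  refine Prod.ext ?_ (Prod.ext ?_ ?_) <;> simp [hkB, hkBinv]

/-- The symmetric generating set `{A_i^{±1}, B_i^{±1}}`. [folklore] -/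
def hkGens (k : ℕ) : Finset (HK k) :=
  (Finset.univ.image hkA ∪ Finset.univ.image hkB) ∪ (Finset.univ.image hkAinv ∪ Finset.univ.image hkBinv)

/-- Membership in the generating set. [folklore] -/
theorem mem_hkGens_iff (s : HK k) : s ∈ hkGens k ↔ ∃ i : Fin k, s = hkA i ∨ s = hkB i ∨ s = hkAinv i ∨ s = hkBinv i := by
  simp only [hkGens, Finset.mem_union, Finset.mem_image, Finset.mem_univ, true_and]
  constructor
  · rintro ((⟨i, rfl⟩ | ⟨i, rfl⟩) | (⟨i, rfl⟩ | ⟨i, rfl⟩))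
    · exact ⟨i, Or.inl rfl⟩
    · exact ⟨i, Or.inr (Or.inl rfl)⟩
    · exact ⟨i, Or.inr (Or.inr (Or.inl rfl))⟩
    · exact ⟨i, Or.inr (Or.inr (Or.inr rfl))⟩
  · rintro ⟨i, rfl | rfl | rfl | rfl⟩
    · exact Or.inl (Or.inl ⟨i, rfl⟩)
    · exact Or.inl (Or.inr ⟨i, rfl⟩)
    · exact Or.inr (Or.inl ⟨i, rfl⟩)
    · exact Or.inr (Or.inr ⟨i, rfl⟩)

/-- `A_i ∈ S`. [folklore] -/
theorem hkA_mem (i : Fin k) : (hkA i : HK k) ∈ hkGens k := (mem_hkGens_iff _).2 ⟨i, Or.inl rfl⟩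
/-- `B_i ∈ S`. [folklore] -/
theorem hkB_mem (i : Fin k) : (hkB i : HK k) ∈ hkGens k := (mem_hkGens_iff _).2 ⟨i, Or.inr (Or.inl rfl)⟩
/-- `A_i⁻¹ ∈ S`. [folklore] -/
theorem hkAinv_mem (i : Fin k) : (hkAinv i : HK k) ∈ hkGens k := (mem_hkGens_iff _).2 ⟨i, Or.inr (Or.inr (Or.inl rfl))⟩
/-- `B_i⁻¹ ∈ S`. [folklore] -/
theorem hkBinv_mem (i : Fin k) : (hkBinv i : HK k) ∈ hkGens k := (mem_hkGens_iff _).2 ⟨i, Or.inr (Or.inr (Or.inr rfl))⟩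

/-- **The Cayley graph `Cay(H_{2k+1}(ℤ); A_i, B_i)`**: `x ∼ x A_i`, `x ∼ x B_i` (`fromRel` symmetrises). [cite: BenjaminiSchramm1996, §2] -/
def hkGraph (k : ℕ) : SimpleGraph (HK k) := SimpleGraph.fromRel fun x y => ∃ i : Fin k, y = hkMul x (hkA i) ∨ y = hkMul x (hkB i)

/-- A generator differs from `1` in its `a`- or `b`-part. [folklore] -/
theorem hkMul_gen_ne (x : HK k) {s : HK k} (hs : s ∈ hkGens k) : x ≠ hkMul x s := by
  obtain ⟨i, rfl | rfl | rfl | rfl⟩ := (mem_hkGens_iff s).1 hs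
  · intro h; have h1 := congrArg (fun z : HK k => z.1 i) h; simp [hkA] at h1
  · intro h; have h1 := congrArg (fun z : HK k => z.2.1 i) h; simp [hkB] at h1
  · intro h; have h1 := congrArg (fun z : HK k => z.1 i) h; simp [hkAinv] at h1
  · intro h; have h1 := congrArg (fun z : HK k => z.2.1 i) h; simp [hkBinv] at h1

/-- Adjacency: `y = x s` for a generator `s ∈ S`. [folklore] -/
theorem hkGraph_adj_iff (x y : HK k) : (hkGraph k).Adj x y ↔ ∃ s ∈ hkGens k, y = hkMul x s := by
  rw [hkGraph, SimpleGraph.fromRel_adj]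
  constructor
  · rintro ⟨-, ⟨i, rfl | rfl⟩ | ⟨i, rfl | rfl⟩⟩
    · exact ⟨hkA i, hkA_mem i, rfl⟩
    · exact ⟨hkB i, hkB_mem i, rfl⟩
    · exact ⟨hkAinv i, hkAinv_mem i, by rw [hkMul_assoc, hkA_mul_hkAinv, hkMul_zero]⟩
    · exact ⟨hkBinv i, hkBinv_mem i, by rw [hkMul_assoc, hkB_mul_hkBinv, hkMul_zero]⟩
  · rintro ⟨s, hs, rfl⟩
    refine ⟨hkMul_gen_ne x hs, ?_⟩
    obtain ⟨i, rfl | rfl | rfl | rfl⟩ := (mem_hkGens_iff s).1 hs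
    · exact Or.inl ⟨i, Or.inl rfl⟩
    · exact Or.inl ⟨i, Or.inr rfl⟩
    · exact Or.inr ⟨i, Or.inl (by rw [hkMul_assoc, hkAinv_mul_hkA, hkMul_zero])⟩
    · exact Or.inr ⟨i, Or.inr (by rw [hkMul_assoc, hkBinv_mul_hkB, hkMul_zero])⟩

/-- `x ∼ x s` for every `s ∈ S`. [folklore] -/
theorem hkGraph_adj_mul_gen (x : HK k) {s : HK k} (hs : s ∈ hkGens k) : (hkGraph k).Adj x (hkMul x s) :=
  (hkGraph_adj_iff x _).2 ⟨s, hs, rfl⟩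

/-- The neighbours of `x` are the `x s`, `s ∈ S`. [folklore] -/
theorem neighborSet_hkGraph (x : HK k) : (hkGraph k).neighborSet x = ↑((hkGens k).image (hkMul x)) := by
  ext y
  rw [SimpleGraph.mem_neighborSet, hkGraph_adj_iff, Finset.coe_image, Set.mem_image]
  simp only [Finset.mem_coe, eq_comm]

/-- The Cayley graph is locally finite (degree `≤ 4k`). [folklore] -/
instance hkGraph_locallyFinite : (hkGraph k).LocallyFinite := fun x =>
  (((hkGens k).image (hkMul x)).finite_toSet.subset (neighborSet_hkGraph x).le).fintype

/-- Induced subgraphs of `hkGraph k` are locally finite. [folklore] -/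
instance hkGraph_induce_locallyFinite (s : Set (HK k)) : ((hkGraph k).induce s).LocallyFinite := fun x =>
  ((((hkGraph k).neighborSet x.1).toFinite.preimage Subtype.val_injective.injOn).subset
    fun y (hy : ((hkGraph k).induce s).Adj x y) => by simpa [SimpleGraph.mem_neighborSet] using hy).fintype

/-- A generator has `a`- and `b`-coordinates in `{0, ±1}` and no `c`-part. [folklore] -/
theorem hkGens_coords {s : HK k} (hs : s ∈ hkGens k) : (∀ j, |s.1 j| ≤ 1) ∧ (∀ j, |s.2.1 j| ≤ 1) ∧ s.2.2 = 0 := by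
  obtain ⟨i, rfl | rfl | rfl | rfl⟩ := (mem_hkGens_iff s).1 hs
  · exact ⟨fun j => by simp only [hkA, Pi.single_apply]; split_ifs <;> simp, fun j => by simp [hkA], rfl⟩
  · exact ⟨fun j => by simp [hkB], fun j => by simp only [hkB, Pi.single_apply]; split_ifs <;> simp, rfl⟩
  · exact ⟨fun j => by simp only [hkAinv, Pi.neg_apply, Pi.single_apply]; split_ifs <;> simp, fun j => by simp [hkAinv], rfl⟩
  · exact ⟨fun j => by simp [hkBinv], fun j => by simp only [hkBinv, Pi.neg_apply, Pi.single_apply]; split_ifs <;> simp, rfl⟩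

/-! ## §3 Left translations, transitivity -/

/-- Left translation as a permutation. [folklore] -/
def hkLeftEquiv (g : HK k) : HK k ≃ HK k where
  toFun := hkMul g
  invFun := hkMul (hkInv g)
  left_inv x := by rw [← hkMul_assoc, hkInv_mul, zero_hkMul]
  right_inv x := by rw [← hkMul_assoc, mul_hkInv, zero_hkMul]

/-- `hkLeftEquiv g = hkMul g`. [folklore] -/
@[simp] theorem hkLeftEquiv_apply (g x : HK k) : hkLeftEquiv g x = hkMul g x := rfl

/-- **Left translations are automorphisms of the right Cayley graph.** [cite: BenjaminiSchramm1996, §2] -/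
def hkLeftIso (g : HK k) : hkGraph k ≃g hkGraph k where
  toEquiv := hkLeftEquiv g
  map_rel_iff' := by
    intro x y
    simp only [hkLeftEquiv_apply, hkGraph_adj_iff, hkMul_assoc, (hkMul_right_injective g).eq_iff]

/-- `hkLeftIso g` acts by left multiplication. [folklore] -/
@[simp] theorem hkLeftIso_apply (g x : HK k) : hkLeftIso g x = hkMul g x := rfl

/-- The Cayley graph is vertex-transitive. [cite: BenjaminiSchramm1996, §2] -/
theorem hkGraph_transitive : IsGraphTransitive (hkGraph k) := by
  intro x y
  refine ⟨hkLeftIso (hkMul y (hkInv x)), ?_⟩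
  show hkMul (hkMul y (hkInv x)) x = y
  rw [hkMul_assoc, hkInv_mul, hkMul_zero]

/-- … hence quasi-transitive with `V₀ = {1}`. [folklore] -/
theorem hkGraph_quasiTransitive : IsQuasiTransitive (hkGraph k) := by
  classical
  refine ⟨{0}, fun v => ?_⟩
  obtain ⟨γ, hγ⟩ := hkGraph_transitive v 0
  exact ⟨γ, by simp [hγ]⟩

/-- `θ` does not depend on the root. [folklore] -/
theorem theta_hkGraph_eq (v : HK k) (p : unitInterval) : theta (hkGraph k) v p = theta (hkGraph k) 0 p := by
  have h := theta_iso (hkLeftIso v) 0 p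
  have hv : hkLeftIso v 0 = v := by rw [hkLeftIso_apply, hkMul_zero]
  rw [hv] at h
  exact h

/-- `p_c` does not depend on the root. [folklore] -/
theorem criticalProb_hkGraph_eq (v : HK k) : criticalProb (hkGraph k) v = criticalProb (hkGraph k) 0 := by
  have h := criticalProb_iso (hkLeftIso v) 0
  have hv : hkLeftIso v 0 = v := by rw [hkLeftIso_apply, hkMul_zero]
  rw [hv] at h
  exact h

/-! ## §4 The coordinate projections `(a_j, b_j)` (the planar skeleton map) -/

/-- The skeleton map over the generator pair `j`: `(a,b,c) ↦ (a_j, b_j)`. [cite: KozmaNitzan2024, §4 p. 15] -/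
def hkAb (j : Fin k) (x : HK k) : Site 2 := ![x.1 j, x.2.1 j]

/-- First skeleton coordinate. [folklore] -/
@[simp] theorem hkAb_apply_zero (j : Fin k) (x : HK k) : hkAb j x 0 = x.1 j := rfl
/-- Second skeleton coordinate. [folklore] -/
@[simp] theorem hkAb_apply_one (j : Fin k) (x : HK k) : hkAb j x 1 = x.2.1 j := rfl
/-- `hkAb j 1 = 0`. [folklore] -/
@[simp] theorem hkAb_zero (j : Fin k) : hkAb j (0 : HK k) = 0 := by
  ext i; fin_cases i <;> simp [hkAb]

/-- The skeleton map is additive (a homomorphism to `ℤ²`). [folklore] -/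
theorem hkAb_hkMul (j : Fin k) (x y : HK k) : hkAb j (hkMul x y) = hkAb j x + hkAb j y := by
  ext i; fin_cases i <;> simp [hkAb]

/-- **1-Lipschitz along edges** (sup-norm on `ℤ²`). [folklore] -/
theorem abs_hkAb_sub_le_one (j : Fin k) {x y : HK k} (h : (hkGraph k).Adj x y) (i : Fin 2) : |hkAb j x i - hkAb j y i| ≤ 1 := by
  obtain ⟨s, hs, rfl⟩ := (hkGraph_adj_iff x y).1 h
  obtain ⟨ha, hb, -⟩ := hkGens_coords hs
  rw [hkAb_hkMul, Pi.add_apply, sub_add_cancel_left, abs_neg]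
  fin_cases i
  · exact ha j
  · exact hb j

end Summit.CriticalPhenomena.PercolationContinuityZ3.Theorems.Transplant

end
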